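import Summits.BirchSwinnertonDyer.BirchSwinnertonDyer.Theorems.CyclotomicUntwistGLTwoFThreeSecondEigenline
import Literature.NumberTheory.EllipticCurves.ModThreeReducibleIffPsi3Root
import Literature.NumberTheory.EllipticCurves.SerreOpenImageDeterminantProofs
import HarnessLib

/-!
# `E[3]` with a UNIQUE stable line has an element of order divisible by `3` in its Galois image —
# the Galois-module step of LAW L-irr3 (`Irr ⇒ Surj` at `3`), over any field of characteristic `0`

Cell `pub/bsd-wall` (D-0145 line `route-BirchSwinnertonDyer-CyclotomicUntwist`), seat `bsd-line-cycu-p4`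
(width seat 4, gen 6). Helper toward the cruxes K1 `PSRankOneLowerHalfAtThree`
(stmt-BirchSwinnertonDyer-21580) and K2 `PSRankOneUpperHalfAtThree` (stmt-21581), whose rows carry the
binder `Surj W 3`. THEOREMS ONLY (no definition, no named fact, no `sorry`); BSD is not proved by this file
and no crux is. Second of three files of LAW L-irr3 (file 1: `…GLTwoFThreeSecondEigenline`, the finite
group theory in `GL₂(𝔽₃)`; file 3: the assembly over `ℚ` at the prime `3`).

For an elliptic curve `V` over a field `K` of characteristic `0`, let `M = V[3](K̄)` with its
`Γ_K`-action (`geomTorsion`, `galoisRepTorsion`). §1 records the three-element lines `{0, ±P}` of `M`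
and the sign action of `Γ_K` on a stable one. §2, **`exists_three_dvd_orderOf_of_unique_stableLine`**: if
`M` has a `Γ_K`-stable subgroup of order `3` and only ONE, then some `σ ∈ Γ_K` acts on `M` with order
divisible by `3`. Proof: frame `M ≅ 𝔽₃²`, `Aut M ≅ GL₂(𝔽₃)` (tree `exists_addEquiv_mulEquiv_addAut_GL2`,
`#M = 9` by `natCard_geomTorsion`); the stable line is a common eigenvector of the image; if no `ρ̄(σ)`
had order divisible by `3`, file 1 (`exists_second_common_eigenvector`) would give a second common
eigenvector, i.e. a second stable subgroup of order `3` — excluded. In classical words: a reducible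
NON-split `E[3]` has wild (order-`3`) elements in its image. File 3 feeds the hypothesis from "exactly
one `ℚ₃`-root of `Ψ₃`" and moves `σ` from `Γ_{ℚ₃}` to `Γ_ℚ`.

References: J.-P. Serre, Invent. Math. 15 (1972) §2.4 [Serre1972]; J. E. Cremona, *Algorithms for Modular
Elliptic Curves* (1997) §3.8 [Cremona1997]; J. H. Silverman, *AEC* (2009) III.4.12, Ex. 3.7 [SilvermanAEC2009].
-/

-- single-conjunct summit: `Summit.BirchSwinnertonDyer.BirchSwinnertonDyer.…` repeats the name by design
set_option linter.dupNamespace false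
set_option autoImplicit false

noncomputable section

open scoped Classical

universe u

namespace Summit.BirchSwinnertonDyer.BirchSwinnertonDyer.Theorems.PSIrrSurjThree

open Matrix WeierstrassCurve Field Literature.NumberTheory.EllipticCurves

variable {K : Type u} [Field K] (V : WeierstrassCurve K)

/-! ### §1 Lines `{0, ±P}` in `E[3]` and the sign action on a stable one -/

/-- `2P = −P` for `P ∈ E[3]`. [folklore] -/
theorem two_nsmul_eq_neg (P : geomTorsion V (3 : ℕ)) : (2 : ℕ) • P = -P := by
  have h3 : (2 : ℕ) • P + P = 0 := by
    rw [← succ_nsmul]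
    exact AddSubgroup.torsionBy.nsmul P
  exact eq_neg_of_add_eq_zero_left h3

/-- The subgroup generated by `P ∈ E[3]` is `{0, P, −P}`. [folklore] -/
theorem mem_zmultiples_iff_of_three (P Q : geomTorsion V (3 : ℕ)) :
    Q ∈ AddSubgroup.zmultiples P ↔ Q = 0 ∨ Q = P ∨ Q = -P := by
  have h3P : (3 : ℤ) • P = 0 := by
    rw [show (3 : ℤ) = ((3 : ℕ) : ℤ) by norm_num, natCast_zsmul]
    exact AddSubgroup.torsionBy.nsmul P
  constructor
  · intro hQ
    obtain ⟨k, hk⟩ := AddSubgroup.mem_zmultiples_iff.mp hQ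
    obtain ⟨q, r, hkqr, hr⟩ : ∃ q r : ℤ, k = r + q * 3 ∧ (r = 0 ∨ r = 1 ∨ r = 2) :=
      ⟨k / 3, k % 3, by omega, by omega⟩
    have hk3 : k • P = r • P := by
      rw [hkqr, add_zsmul, mul_zsmul, h3P, zsmul_zero, add_zero]
    rw [← hk, hk3]
    rcases hr with h | h | h
    · exact Or.inl (by rw [h, zero_zsmul])
    · exact Or.inr (Or.inl (by rw [h, one_zsmul]))
    · exact Or.inr (Or.inr (by
        rw [h, show (2 : ℤ) = ((2 : ℕ) : ℤ) by norm_num, natCast_zsmul, two_nsmul_eq_neg]))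
  · rintro (h | h | h)
    · rw [h]; exact zero_mem _
    · rw [h]; exact AddSubgroup.mem_zmultiples P
    · rw [h]; exact neg_mem (AddSubgroup.mem_zmultiples P)

/-- **`Γ_K` acts on a stable line by a sign**: if `{0, ±P}` (`P ≠ 0`) is `Γ_K`-stable then
`σ • P = P` or `σ • P = −P` for every `σ`. [cite: Cremona1997, §3.8 (l = 3)] -/
theorem smul_eq_or_eq_neg_of_stable {P : geomTorsion V (3 : ℕ)} (hP0 : P ≠ 0)
    (hH : ∀ σ : absoluteGaloisGroup K, ∀ Q ∈ AddSubgroup.zmultiples P, σ • Q ∈ AddSubgroup.zmultiples P)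
    (σ : absoluteGaloisGroup K) : σ • P = P ∨ σ • P = -P := by
  have hmem : σ • P ∈ AddSubgroup.zmultiples P := hH σ P (AddSubgroup.mem_zmultiples P)
  rw [mem_zmultiples_iff_of_three] at hmem
  rcases hmem with h | h | h
  · exfalso
    apply hP0
    have := congrArg (fun Q ↦ σ⁻¹ • Q) h
    simpa using this
  · exact Or.inl h
  · exact Or.inr h

/-- The line `{0, ±P}` of a non-zero `P ∈ E[3]` has `3` elements. [folklore] -/
theorem natCard_zmultiples_eq_three {P : geomTorsion V (3 : ℕ)} (hP0 : P ≠ 0) :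
    Nat.card (AddSubgroup.zmultiples P) = 3 := by
  haveI : Fact (Nat.Prime 3) := ⟨Nat.prime_three⟩
  rw [Nat.card_zmultiples]
  exact addOrderOf_eq_prime (AddSubgroup.torsionBy.nsmul P) hP0

/-- The line of `P` is `Γ_K`-stable as soon as `σ • P = ±P` for every `σ`. [folklore] -/
theorem zmultiples_stable_of_smul_eq {P : geomTorsion V (3 : ℕ)}
    (h : ∀ σ : absoluteGaloisGroup K, σ • P = P ∨ σ • P = -P) (σ : absoluteGaloisGroup K)
    (Q : geomTorsion V (3 : ℕ)) (hQ : Q ∈ AddSubgroup.zmultiples P) :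
    σ • Q ∈ AddSubgroup.zmultiples P := by
  rw [mem_zmultiples_iff_of_three] at hQ ⊢
  rcases hQ with rfl | rfl | rfl
  · exact Or.inl (smul_zero σ)
  · rcases h σ with h | h
    · exact Or.inr (Or.inl h)
    · exact Or.inr (Or.inr h)
  · rcases h σ with h | h
    · exact Or.inr (Or.inr (by rw [smul_neg, h]))
    · exact Or.inr (Or.inl (by rw [smul_neg, h, neg_neg]))

/-! ### §2 A unique stable line forces an element of order divisible by `3` -/

/-- **A reducible NON-split `E[3]` has wild elements in its image.** Let `V/K` be an elliptic curve
(`char K = 0`). If `E[3] = V[3](K̄)` has a `Γ_K`-stable subgroup `H` of order `3` and every `Γ_K`-stable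
subgroup of order `3` equals `H` (exactly ONE stable line), then some `σ ∈ Γ_K` acts on `E[3]` through
an automorphism of order divisible by `3`. (Frame `E[3] ≅ 𝔽₃²`; the line is a common eigenvector of the
image; were every `ρ̄(σ)` of order prime to `3`, the image would have a second common eigenvector — file 1,
`exists_second_common_eigenvector` — i.e. a second stable line.) [cite: Serre1972, §2.4 Prop. 15]
[cite: Cremona1997, §3.8 (l = 3)] -/
theorem exists_three_dvd_orderOf_of_unique_stableLine [CharZero K] [V.IsElliptic]
    (H : AddSubgroup (geomTorsion V (3 : ℕ)))
    (hH : ∀ σ : absoluteGaloisGroup K, ∀ P ∈ H, σ • P ∈ H) (hcard : Nat.card H = 3)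
    (huniq : ∀ H' : AddSubgroup (geomTorsion V (3 : ℕ)),
      (∀ σ : absoluteGaloisGroup K, ∀ P ∈ H', σ • P ∈ H') → Nat.card H' = 3 → H' = H) :
    ∃ σ : absoluteGaloisGroup K, 3 ∣ orderOf (galoisRepTorsion V (3 : ℕ) σ) := by
  haveI : Fact (Nat.Prime 3) := ⟨Nat.prime_three⟩
  haveI : NeZero ((3 : ℕ) : K) := ⟨by norm_num⟩
  letI : Module (ZMod 3) (geomTorsion V (3 : ℕ)) := AddSubgroup.torsionBy.zmodModule
  by_contra hno
  push Not at hno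
  -- a frame `e : E[3] ≃+ 𝔽₃²`, `Φ : Aut E[3] ≅ GL₂(𝔽₃)`
  obtain ⟨e, Φ, he, -, -⟩ := exists_addEquiv_mulEquiv_addAut_GL2 (geomTorsion V (3 : ℕ))
    (Literature.NumberTheory.EllipticCurves.natCard_geomTorsion V 3)
  -- a generator of the stable line
  obtain ⟨P₀, hP₀, rfl⟩ := Mazur1978.exists_eq_zmultiples_of_natCard_eq V 3 hcard
  have hpm := smul_eq_or_eq_neg_of_stable V hP₀ hH
  -- the image in `GL₂(𝔽₃)`
  set f : absoluteGaloisGroup K →* GL (Fin 2) (ZMod 3) :=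
    Φ.toMonoidHom.comp (galoisRepTorsion V (3 : ℕ)) with hf
  have hfapply : ∀ (σ : absoluteGaloisGroup K) (Q : geomTorsion V (3 : ℕ)),
      (f σ : Matrix (Fin 2) (Fin 2) (ZMod 3)) *ᵥ e Q = e (σ • Q) := fun σ Q ↦
    (he (galoisRepTorsion V (3 : ℕ) σ) Q).symm
  have hf3 : ∀ σ : absoluteGaloisGroup K, ¬ 3 ∣ orderOf (f σ) := by
    intro σ h
    rw [hf, MonoidHom.comp_apply, MulEquiv.coe_toMonoidHom, MulEquiv.orderOf_eq] at h
    exact hno σ h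
  -- `v := e P₀` is a common eigenvector
  have hv : e P₀ ≠ 0 := fun h ↦ hP₀ (e.injective (by rw [h, map_zero]))
  have hfv : ∀ σ : absoluteGaloisGroup K, ∃ c : ZMod 3,
      (f σ : Matrix (Fin 2) (Fin 2) (ZMod 3)) *ᵥ e P₀ = c • e P₀ := by
    intro σ
    rcases hpm σ with h | h
    · exact ⟨1, by rw [hfapply, h, one_smul]⟩
    · exact ⟨-1, by rw [hfapply, h, map_neg, neg_one_smul]⟩
  -- hence a second common eigenvector `w`, i.e. a second stable line `{0, ± e⁻¹ w}`
  obtain ⟨w, hw0, hwv, hfw⟩ := exists_second_common_eigenvector f hf3 hv hfv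
  set Q₀ : geomTorsion V (3 : ℕ) := e.symm w with hQ₀
  have heQ₀ : e Q₀ = w := e.apply_symm_apply w
  have hQ₀0 : Q₀ ≠ 0 := fun h ↦ hw0 (by rw [← heQ₀, h, map_zero])
  have hQpm : ∀ σ : absoluteGaloisGroup K, σ • Q₀ = Q₀ ∨ σ • Q₀ = -Q₀ := by
    intro σ
    obtain ⟨c, hc⟩ := hfw σ
    rw [← heQ₀, hfapply] at hc
    -- `e (σ • Q₀) = c • e Q₀ = e (c • Q₀)`, so `σ • Q₀ = c • Q₀` with `c ∈ {0, 1, 2}`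
    have hc' : σ • Q₀ = (c.val : ℕ) • Q₀ := by
      apply e.injective
      rw [map_nsmul, hc]
      conv_lhs => rw [← ZMod.natCast_zmod_val c]
      exact Nat.cast_smul_eq_nsmul _ _ _
    have hcval : c.val < 3 := c.val_lt
    interval_cases hcv : c.val
    · exfalso
      rw [zero_nsmul] at hc'
      apply hQ₀0
      have := congrArg (fun Q ↦ σ⁻¹ • Q) hc'
      simpa using this
    · exact Or.inl (by rw [hc', one_nsmul])
    · exact Or.inr (by rw [hc', two_nsmul_eq_neg])
  have hstab := zmultiples_stable_of_smul_eq V hQpm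
  have hcard' := natCard_zmultiples_eq_three V hQ₀0
  have hEq := huniq _ hstab hcard'
  -- so `Q₀ ∈ {0, ±P₀}` and `w = e Q₀` lies on the line of `v` — contradiction
  have hmem : Q₀ ∈ AddSubgroup.zmultiples P₀ := hEq ▸ AddSubgroup.mem_zmultiples Q₀
  rw [mem_zmultiples_iff_of_three] at hmem
  rcases hmem with h | h | h
  · exact hQ₀0 h
  · exact hwv 1 (by rw [← heQ₀, h, one_smul])
  · exact hwv (-1) (by rw [← heQ₀, h, map_neg, neg_one_smul])

end Summit.BirchSwinnertonDyer.BirchSwinnertonDyer.Theorems.PSIrrSurjThree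

end
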